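import Literature.AnabelianGeometry.Anabelioids.Basic
import HarnessLib

/-!
# Anabelioids: proof of the named fact `image_factorization` of `Anabelioids/Basic.lean`

Mochizuki, *The geometry of anabelioids*, Publ. RIMS **40** (2004), §1.1 p. 14
[cite: MochizukiGeoAn2004, §1.1 p.14]: for a morphism `φ : X → Y` of connected anabelioids, "the
induced morphisms of fundamental groups `π₁(X) ↠ π₁(I_φ) ↪ π₁(Y)` are a surjection followed by an
injection", rendered in the statement file `Literature.AnabelianGeometry.Anabelioids.Basic` as
the named fact `image_factorization`: the kernel of `π₁(φ) : Aut(β) → Aut(φ ∘ β)` coincides with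
the kernel of `Aut(β) → Aut(ι ⋙ β)`, `ι : I_φ ⥤ X` the inclusion of the image anabelioid (the
full subcategory on subquotients of objects `φ^* B`).

Proof (`image_factorization_holds`): an automorphism `σ` of the fibre functor that is the
identity on every `φ^* B` is the identity on every subobject `S ↪ φ^* B` (the fibre functor
preserves monomorphisms, cancel the mono) and then on every quotient `S ↠ A` (it preserves
epimorphisms, cancel the epi); the converse holds because `φ^* B` is a subquotient of itself.

Proof-only: no definitions, nothing of the statement file is restated.
-/

namespace Literature.AnabelianGeometry.Anabelioids

open CategoryTheory CategoryTheory.Limits CategoryTheory.PreGaloisCategory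

universe v₁ v₂ u₁ u₂

section

variable {X : Type u₁} [Category.{v₁} X] {Y : Type u₂} [Category.{v₂} Y]

/-- The unit of `Aut(Z)` is the identity natural transformation, componentwise. [folklore] -/
private theorem aut_one_hom_app {D : Type u₂} [Category.{v₂} D] (Z : X ⥤ D) (A : X) :
    (1 : Aut Z).hom.app A = 𝟙 (Z.obj A) :=
  rfl

/-- Membership in the kernel of `π₁(P) : Aut(F) → Aut(P ⋙ F)` is componentwise triviality on the
objects `P B`. [folklore] -/
private theorem mem_ker_pi1Map_iff (P : Y ⥤ X) (F : X ⥤ FintypeCat.{v₁}) (σ : Aut F) :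
    σ ∈ (pi1Map P F).ker ↔ ∀ B : Y, σ.hom.app (P.obj B) = 𝟙 _ := by
  rw [MonoidHom.mem_ker]
  constructor
  · intro h B
    have := congrArg (fun τ : Aut (P ⋙ F) => τ.hom.app B) h
    simp only [pi1Map_hom_app, aut_one_hom_app] at this
    exact this
  · intro h
    apply Iso.ext
    apply NatTrans.ext
    funext B
    rw [pi1Map_hom_app, aut_one_hom_app]
    exact h B

end

/-- NAMED FACT `image_factorization` ([GeoAn] §1.1 p. 14: "`π₁(X) ↠ π₁(I_φ) ↪ π₁(Y)` is a
surjection followed by an injection"), PROVED in the rendered form: the kernels of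
`π₁(X, β) → π₁(Y, φ ∘ β)` and of `π₁(X, β) → Aut(ι ⋙ β)` (`ι : I_φ ⥤ X`) coincide.  An
automorphism of the fibre functor trivial on all `φ^* B` is trivial on subobjects of these
(cancel the mono `F(S) ↪ F(φ^* B)`) and then on their quotients (cancel the epi `F(S) ↠ F(A)`).
[cite: MochizukiGeoAn2004, §1.1 p.14] -/
theorem image_factorization_holds : image_factorization.{v₁, v₂, u₁, u₂} := by
  intro X _ Y _ _ _ φ F _
  ext σ
  rw [mem_ker_pi1Map_iff, mem_ker_pi1Map_iff]
  constructor
  · intro h A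
    change σ.hom.app A.obj = 𝟙 (F.obj A.obj)
    obtain ⟨B, S, i, q, hi, hq⟩ := A.property
    -- trivial on the subobject `S ↪ φ^* B`
    have hS : σ.hom.app S = 𝟙 _ := by
      have nat := σ.hom.naturality i
      rw [h B, Category.comp_id] at nat
      -- nat : F.map i = σ.hom.app S ≫ F.map i
      haveI : Mono (F.map i) := F.map_mono i
      rw [← cancel_mono (F.map i), Category.id_comp]
      exact nat.symm
    -- hence trivial on the quotient `S ↠ A`
    have nat := σ.hom.naturality q
    rw [hS, Category.id_comp] at nat
    -- nat : F.map q ≫ σ.hom.app A.obj = F.map q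
    haveI : Epi (F.map q) := F.map_epi q
    rw [← cancel_epi (F.map q), Category.comp_id]
    exact nat
  · intro h B
    exact h ⟨φ.pullback.obj B, B, φ.pullback.obj B, 𝟙 _, 𝟙 _, inferInstance, inferInstance⟩

end Literature.AnabelianGeometry.Anabelioids
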